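import Summits.BirchSwinnertonDyer.Rank1Residual.O5.O5KummerLine
import Literature.NumberTheory.EllipticCurves.ModThreeReducibleIffPsi3Root
import HarnessLib

/-!
# O5 G3-1 `LocalShapeTprimeThree` PROVED: `LocIrr W 3 ↔ numStableLinesAtThree W = 0` for EVERY elliptic
# curve over `ℚ` (cell `b2b-bsdres`, harvest seat 2, GEN 42, note E89; theorems only)

HONEST FRAMING (cell `b2b-bsdres`, run/shared/lean/b2b/bsd-rank1-residual/, verbatim in every file): the goal of
the cell is to DELETE the COMBINATION-SHAPED residual classes of the Birch–Swinnerton-Dyer formula for ALL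
analytic-rank `≤ 1` elliptic curves over `ℚ` — "full BSD formula for every rank `≤ 1` curve in class `C`"
assembled STRICTLY from published theorems — so that the rank-`≤ 1` remainder becomes exactly the
CONSTRUCTION-SHAPED classes, which are TYPED (missing-input `Prop`s), NOT attempted. This is not "finishing
BSD". This file: THEOREMS ONLY (no definition, no named fact, no `@[conjecture]` node; net named-fact debt `0`);
nothing about any particular curve is asserted; nothing is booked; no mark of `RESIDUAL-MAP.md` moves.

## What is proved

o5-r1 GEN 3's THEOREM-CANDIDATE **G3-1 `O5.LocalShapeTprimeThree`** (`O5/O5CompanionTransport.lean`: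
`ClassO5 W 3 → SubTprime W 3 → (LocIrr W 3 ↔ numStableLinesAtThree W = 0)`, "elementary local Galois
theory", consumed as the hypothesis `hshape` of `O5.kummerTorsorsAgree_of_cases` in `O5/O5KummerLine.lean`) is the
`K = ℚ₃` instance of the published dictionary "`E[3]` is a reducible `Γ_K`-module iff the `3`-division
polynomial `Ψ₃` has a root in `K`" (Cremona 1997 §3.8; Silverman AEC III.4.12, Rem. III.4.13.2, Ex. 3.7), now a
tree theorem over every field of characteristic `0`
(`Literature/NumberTheory/EllipticCurves/ModThreeReducibleIffPsi3Root.lean`,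
`WeierstrassCurve.hasIrreducibleModPGaloisRep_three_iff_forall_not_isRoot_Ψ₃`), applied to
`W.baseChange ℚ_[3]`: `LocIrr W 3 := (W.baseChange ℚ_[3]).HasIrreducibleModPGaloisRep 3`
(`Additive/FouquetWanLocus.lean`) and `numStableLinesAtThree W := #(roots of Ψ₃ in ℚ₃)`
(`O5/O5CompanionTransport.lean`). Hence, with NO class hypothesis (no `ClassO5`, no `SubTprime`, any Kodaira
symbol, wild or tame):

* `numStableLinesAtThree_eq_zero_iff` — `numStableLinesAtThree W = 0 ↔ ∀ r : ℚ₃, ¬ Ψ₃(r) = 0`;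
* `locIrr_three_iff_forall_not_isRoot` — `LocIrr W 3 ↔ ∀ r : ℚ₃, ¬ Ψ₃(r) = 0` (this is, word for word,
  cc-typer-5 GEN 7's draft node `LocIrrIffShapeIrrThree` of `Additive/WildThreeResidualShapeLaws.lean`,
  `ShapeIrrThree W := ∀ r, ¬ ((W.baseChange ℚ_[3]).Ψ₃).IsRoot r` — a THEOREM, not a conjecture);
* `locIrr_three_iff_numStableLinesAtThree_eq_zero` — `LocIrr W 3 ↔ numStableLinesAtThree W = 0`;
* `not_locIrr_three_iff_numStableLinesAtThree_pos` — reducible iff at least one `ℚ₃`-root;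
* **`localShapeTprimeThree_holds : LocalShapeTprimeThree`** — the O5 node discharged;
* `kummerTorsorsAgree_of_cases'` — `O5.kummerTorsorsAgree_of_cases` with the `hshape` hypothesis removed
  (remaining inputs: `NonSplitAtThreeLaw`, T18″ `KummerLineTransferReducibleThree`, L3-irr
  `KummerLineTransferLocIrrThree`, unchanged).

References: [Cremona1997] §3.8; [SilvermanAEC2009] III.4.12, Remark III.4.13.2, Exercise 3.7; cell notes
`HOME/b2b-bsdres-harvest-2/gen42/E89-*.md`, `cells/o5o6/TARGETS.md` §O5 (o5-r1 GEN 3, G3-1).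
-/

set_option autoImplicit false

noncomputable section

open scoped Classical

open Polynomial WeierstrassCurve Literature.NumberTheory.EllipticCurves
  Summit.BirchSwinnertonDyer.Rank1Residual.Additive

namespace Summit.BirchSwinnertonDyer.Rank1Residual.O5

/-! ## §1 The root count over `ℚ₃` -/

/-- `numStableLinesAtThree W = 0` iff `Ψ₃` has no root in `ℚ₃` (`Ψ₃ ≠ 0`: leading coefficient `3`).
[folklore] -/
theorem numStableLinesAtThree_eq_zero_iff (W : WeierstrassCurve ℚ) :
    numStableLinesAtThree W = 0 ↔ ∀ r : ℚ_[3], ¬ ((W.baseChange ℚ_[3]).Ψ₃).IsRoot r := by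
  have hbc : (W.baseChange ℚ_[3]).Ψ₃ = (W.Ψ₃).map (algebraMap ℚ ℚ_[3]) := by
    rw [WeierstrassCurve.baseChange, map_Ψ₃]
  have hne : (W.Ψ₃).map (algebraMap ℚ ℚ_[3]) ≠ 0 := by
    rw [← hbc]
    exact Ψ₃_ne_zero _ (by norm_num)
  unfold numStableLinesAtThree
  rw [Finset.card_eq_zero, Multiset.toFinset_eq_empty, hbc]
  constructor
  · intro h r hr
    have hmem : r ∈ ((W.Ψ₃).map (algebraMap ℚ ℚ_[3])).roots := (mem_roots hne).2 hr
    rw [h] at hmem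
    exact Multiset.notMem_zero _ hmem
  · intro h
    exact Multiset.eq_zero_of_forall_notMem fun r hr ↦ h r ((mem_roots hne).1 hr)

/-- `0 < numStableLinesAtThree W` iff `Ψ₃` has a root in `ℚ₃`. [folklore] -/
theorem numStableLinesAtThree_pos_iff (W : WeierstrassCurve ℚ) :
    0 < numStableLinesAtThree W ↔ ∃ r : ℚ_[3], ((W.baseChange ℚ_[3]).Ψ₃).IsRoot r := by
  rw [pos_iff_ne_zero, Ne, numStableLinesAtThree_eq_zero_iff]
  push Not
  rfl

/-! ## §2 `LocIrr W 3` read off `Ψ₃` over `ℚ₃` — for every elliptic curve over `ℚ` -/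

section LocIrr

variable (W : WeierstrassCurve ℚ) [W.IsElliptic]

/-- **`LocIrr W 3 ↔ Ψ₃` has no root in `ℚ₃`**, for every elliptic curve over `ℚ`: the `K = ℚ₃` case of
"`E[3]` reducible over `K` iff `Ψ₃` has a `K`-root" applied to `W/ℚ₃`. (= cc-typer-5's `LocIrrIffShapeIrrThree`.)
[cite: Cremona1997, §3.8 (l = 3)] [cite: SilvermanAEC2009, III.4.12, Remark III.4.13.2 and Exercise 3.7] -/
theorem locIrr_three_iff_forall_not_isRoot :
    LocIrr W 3 ↔ ∀ r : ℚ_[3], ¬ ((W.baseChange ℚ_[3]).Ψ₃).IsRoot r :=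
  (W.baseChange ℚ_[3]).hasIrreducibleModPGaloisRep_three_iff_forall_not_isRoot_Ψ₃

/-- **`LocIrr W 3 ↔ numStableLinesAtThree W = 0`**, for every elliptic curve over `ℚ` (no class hypothesis).
[cite: Cremona1997, §3.8 (l = 3)] [cite: SilvermanAEC2009, III.4.12, Remark III.4.13.2 and Exercise 3.7] -/
theorem locIrr_three_iff_numStableLinesAtThree_eq_zero :
    LocIrr W 3 ↔ numStableLinesAtThree W = 0 := by
  rw [numStableLinesAtThree_eq_zero_iff]
  exact locIrr_three_iff_forall_not_isRoot W

/-- **`E[3]|G_{ℚ₃}` reducible iff `Ψ₃` has at least one root in `ℚ₃`** (`numStableLinesAtThree W ≥ 1`).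
[cite: Cremona1997, §3.8 (l = 3)] -/
theorem not_locIrr_three_iff_numStableLinesAtThree_pos :
    ¬ LocIrr W 3 ↔ 0 < numStableLinesAtThree W := by
  rw [locIrr_three_iff_numStableLinesAtThree_eq_zero, pos_iff_ne_zero]

/-- A `ℚ₃`-root of `Ψ₃` makes `E[3]|G_{ℚ₃}` reducible. [cite: Cremona1997, §3.8 (l = 3)] -/
theorem not_locIrr_three_of_isRoot {r : ℚ_[3]} (hr : ((W.baseChange ℚ_[3]).Ψ₃).IsRoot r) :
    ¬ LocIrr W 3 :=
  (W.baseChange ℚ_[3]).not_hasIrreducibleModPGaloisRep_three_of_isRoot_Ψ₃ hr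

/-- A `ℚ`-rational root of `Ψ₃` (a rational `3`-isogeny) makes `E[3]|G_{ℚ₃}` reducible. [cite: Cremona1997, §3.8 (l = 3)] -/
theorem not_locIrr_three_of_isRoot_rat {r : ℚ} (hr : W.Ψ₃.IsRoot r) : ¬ LocIrr W 3 := by
  refine not_locIrr_three_of_isRoot W (r := algebraMap ℚ ℚ_[3] r) ?_
  rw [IsRoot.def, WeierstrassCurve.baseChange, map_Ψ₃, eval_map, eval₂_at_apply, hr.eq_zero, map_zero]

end LocIrr

/-! ## §3 The O5 node and its consumer -/

/-- **G3-1 `LocalShapeTprimeThree` HOLDS** (o5-r1 GEN 3, `O5/O5CompanionTransport.lean`; the class hypotheses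
`ClassO5 W 3`, `SubTprime W 3` are not used). [cite: Cremona1997, §3.8 (l = 3)]
[cite: SilvermanAEC2009, III.4.12, Remark III.4.13.2 and Exercise 3.7] -/
theorem localShapeTprimeThree_holds : LocalShapeTprimeThree := by
  intro W _ _ _ _
  exact locIrr_three_iff_numStableLinesAtThree_eq_zero W

/-- `O5.kummerTorsorsAgree_of_cases` with its `LocalShapeTprimeThree` hypothesis DISCHARGED: T17-local for every
III* O5b curve with big image and a good companion follows from `NonSplitAtThreeLaw`, T18″
(`KummerLineTransferReducibleThree`) and L3-irr (`KummerLineTransferLocIrrThree`) alone. [folklore] -/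
theorem kummerTorsorsAgree_of_cases' (hns : NonSplitAtThreeLaw)
    (hred : KummerLineTransferReducibleThree) (hirr : KummerLineTransferLocIrrThree)
    (W G : WeierstrassCurve ℚ) [W.IsElliptic] [W.IsGloballyMinimal] [G.IsElliptic] [G.IsGloballyMinimal]
    (h5 : ClassO5 W 3) (ht : SubTprime W 3) (hbig : W.HasIrreducibleModPGaloisRep 3)
    (h9 : padicValRat 3 W.Δ = 9) (hc : IsCompanionAtThree W G) (hg : ¬ (3 ∣ G.conductorNorm ℤ))
    (x y x' y' : ℚ_[3]) (hP : IsKummerBasePointThree W x y) (hP' : IsKummerBasePointThree G x' y') :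
    KummerTorsorsAgreeAtThree W G x x' :=
  kummerTorsorsAgree_of_cases localShapeTprimeThree_holds hns hred hirr W G h5 ht hbig h9 hc hg x y x' y' hP hP'

end Summit.BirchSwinnertonDyer.Rank1Residual.O5
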